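import Literature.NumberTheory.Automorphic.UnitaryGroupGlobalGenericity
import Literature.NumberTheory.Automorphic.UnitaryGroupTraceZeroLattice
import Literature.NumberTheory.Automorphic.UnitaryGroupHeisenbergHaar
import HarnessLib

/-!
# The line unipotent radical of `U(J₂)`: `N(𝔸_F) ≅ 𝔸_E⁻`

H-side (`H = U(Φ₂) × U(Φ₁)`) copy of the Borel letters of the `T1-qs` LAW road at `N = 2` (brief H-B1 of
`CENSUS-LAWS-Hside`), THEOREMS ONLY over accepted tree modules, definition-free. The unipotent radical of
the upper triangular Borel subgroup of the quasi-split unitary group `U(J₂)` in two variables is the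
one-parameter group `n(b) = 1 + b E₀₁` with `b + c b = 0` (`b ∈ 𝔸_E⁻`, the trace-zero adeles; Rogawski
(1990), §1.9–§1.10, and p. 98: the groups `U(3)`, `U(2)`, `U(2) × U(1)` are treated uniformly). The chart
is the accepted `middleRootUnipotent` ∕ `middleCoord` of `UnitaryGroupGlobalGenericity` at
`(N, i, j) = (2, 0, 1)`; here: at `N = 2` it is a homeomorphic group isomorphism `(𝔸_E⁻, +) ≅ N(𝔸_F)`
(so `N(𝔸_F)` is abelian), the additive Haar measure of `𝔸_E⁻` transports to a Haar measure of `N(𝔸_F)`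
(change of variables, uniqueness), `N(F) = n(E⁻)`, and Tate's domain `𝓕⁻` of `E⁻∖𝔸_E⁻` transports to
a fundamental domain of `N(F)∖N(𝔸_F)` of finite measure (the `N = 2` replacement of
`UnitaryGroupHeisenberg[Haar∕FundamentalDomain]`).

## References

* J. D. Rogawski, *Automorphic Representations of Unitary Groups in Three Variables* (1990), §1.9–§1.10,
  p. 98 [Rogawski1990].
* J. W. S. Cassels, A. Fröhlich (eds.), *Algebraic Number Theory* (1967), Ch. XV Thm. 4.1.3
  [CasselsFrohlichANT1967].
-/

set_option autoImplicit false

open NumberField IsDedekindDomain Topology MeasureTheory Measure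
open scoped Pointwise ENNReal NNReal

namespace Literature.NumberTheory.Automorphic

namespace UnitaryGroup

variable {F E : Type} [Field F] [NumberField F] [Field E] [NumberField E] [Algebra F E]
  {c : E ≃ₐ[F] E}
  (hij : (((0 : Fin 2) : Fin 2) : ℕ) + 1 = (((1 : Fin 2) : Fin 2) : ℕ)) (hN : 2 = 2 * (((0 : Fin 2) : Fin 2) : ℕ) + 2)

/-! ## §1 The chart `b ↦ n(b) = 1 + b E₀₁` is a group isomorphism `𝔸_E⁻ ≅ N(𝔸_F)` -/

section Chart

/-- At `N = 2` every element of `N(𝔸_F)` is supported on the unique simple root: its only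
off-diagonal entry is `u₀₁`. [cite: Rogawski1990, §1.10] -/
theorem isRootSupported_two (u : ↥(adelicUnipotent F E c 2)) : IsRootSupported 0 u := by
  intro j k hjk h
  fin_cases j <;> fin_cases k
  · exact absurd rfl hjk
  · exact Or.inl ⟨rfl, rfl⟩
  · exact absurd (unipotentEntry_eq_zero_of_lt u (show (0 : Fin 2) < 1 by decide)) h
  · exact absurd rfl hjk

/-- **The chart is onto**: every `u ∈ N(𝔸_F)` of `U(J₂)` is `n(u₀₁)`, `u₀₁ ∈ 𝔸_E⁻` its trace-zero
coordinate `middleCoord`. [cite: Rogawski1990, §1.10] -/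
theorem eq_middleRootUnipotent_two (u : ↥(adelicUnipotent F E c 2)) :
    u = middleRootUnipotent hij hN (Multiplicative.ofAdd (middleCoord hij hN u)) :=
  eq_middleRootUnipotent_of_isRootSupported hij hN (isRootSupported_two u)

/-- **The coordinate of `n(b)` is `b`.** [cite: Rogawski1990, §1.10] -/
theorem middleCoord_middleRootUnipotent_two (b : ↥(traceZeroAdele F E c)) :
    middleCoord hij hN (middleRootUnipotent hij hN (Multiplicative.ofAdd b)) = b :=
  Subtype.ext (unipotentEntry_middleRootUnipotent_self hij hN b)

/-- The chart `b ↦ n(b)` is injective. [cite: Rogawski1990, §1.10] -/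
theorem middleRootUnipotent_two_injective :
    Function.Injective fun b : ↥(traceZeroAdele F E c) => middleRootUnipotent hij hN (Multiplicative.ofAdd b) := by
  intro b b' h
  have := congrArg (middleCoord hij hN) h
  simpa only [middleCoord_middleRootUnipotent_two] using this

/-- The chart `b ↦ n(b)` is surjective. [cite: Rogawski1990, §1.10] -/
theorem middleRootUnipotent_two_surjective :
    Function.Surjective fun b : ↥(traceZeroAdele F E c) => middleRootUnipotent hij hN (Multiplicative.ofAdd b) :=
  fun u => ⟨middleCoord hij hN u, (eq_middleRootUnipotent_two hij hN u).symm⟩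

/-- `n(b + b′) = n(b) n(b′)`. [cite: Rogawski1990, §1.10] -/
theorem middleRootUnipotent_add_two (b b' : ↥(traceZeroAdele F E c)) :
    middleRootUnipotent hij hN (Multiplicative.ofAdd (b + b')) =
      middleRootUnipotent hij hN (Multiplicative.ofAdd b) * middleRootUnipotent hij hN (Multiplicative.ofAdd b') := by
  rw [ofAdd_add, map_mul]

/-- **The coordinate is additive**: `(u v)₀₁ = u₀₁ + v₀₁` — `N(𝔸_F)` of `U(J₂)` is a one-parameter
group (no Heisenberg commutator at `N = 2`). [cite: Rogawski1990, §1.10] -/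
theorem middleCoord_mul_two (u v : ↥(adelicUnipotent F E c 2)) :
    middleCoord hij hN (u * v) = middleCoord hij hN u + middleCoord hij hN v := by
  conv_lhs => rw [eq_middleRootUnipotent_two hij hN u, eq_middleRootUnipotent_two hij hN v,
    ← middleRootUnipotent_add_two hij hN]
  rw [middleCoord_middleRootUnipotent_two]

/-- `1₀₁ = 0`. [cite: Rogawski1990, §1.10] -/
theorem middleCoord_one_two : middleCoord hij hN (1 : ↥(adelicUnipotent F E c 2)) = 0 := by
  have h := middleCoord_mul_two hij hN (1 : ↥(adelicUnipotent F E c 2)) 1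
  rw [mul_one] at h
  exact left_eq_add.1 h

/-- `(u⁻¹)₀₁ = -u₀₁`. [cite: Rogawski1990, §1.10] -/
theorem middleCoord_inv_two (u : ↥(adelicUnipotent F E c 2)) :
    middleCoord hij hN u⁻¹ = -middleCoord hij hN u := by
  have h := middleCoord_mul_two hij hN u⁻¹ u
  rw [inv_mul_cancel, middleCoord_one_two] at h
  exact eq_neg_of_add_eq_zero_left h.symm

/-- **`N(𝔸_F)` of `U(J₂)` is ABELIAN.** [cite: Rogawski1990, §1.10] -/
theorem mul_comm_adelicUnipotent_two (u v : ↥(adelicUnipotent F E c 2)) : u * v = v * u := by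
  have hij' : (((0 : Fin 2) : Fin 2) : ℕ) + 1 = (((1 : Fin 2) : Fin 2) : ℕ) := rfl
  have hN' : 2 = 2 * (((0 : Fin 2) : Fin 2) : ℕ) + 2 := rfl
  rw [eq_middleRootUnipotent_two hij' hN' u, eq_middleRootUnipotent_two hij' hN' v,
    ← middleRootUnipotent_add_two, ← middleRootUnipotent_add_two, add_comm]

/-- `N(𝔸_F)` of `U(J₂)` is abelian, in the `unipotentInBorel` spelling (subgroup of `B(𝔸_F)`).
[cite: Rogawski1990, §1.10] -/
theorem mul_comm_unipotentInBorel_two (u v : ↥(unipotentInBorel F E c 2)) : u * v = v * u := by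
  have h := mul_comm_adelicUnipotent_two
    (⟨((u : borelAdelic F E c 2) : (quasiSplit F E c 2).Adelic), u.2⟩ : ↥(adelicUnipotent F E c 2))
    ⟨((v : borelAdelic F E c 2) : (quasiSplit F E c 2).Adelic), v.2⟩
  apply Subtype.ext; apply Subtype.ext
  change ((u : borelAdelic F E c 2) : (quasiSplit F E c 2).Adelic) * ((v : borelAdelic F E c 2) : (quasiSplit F E c 2).Adelic) =
    ((v : borelAdelic F E c 2) : (quasiSplit F E c 2).Adelic) * ((u : borelAdelic F E c 2) : (quasiSplit F E c 2).Adelic)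
  exact congrArg Subtype.val h

/-- The chart `b ↦ n(b)` is continuous. [cite: Rogawski1990, §1.10] -/
theorem continuous_middleRootUnipotent_two :
    Continuous fun b : ↥(traceZeroAdele F E c) => middleRootUnipotent hij hN (Multiplicative.ofAdd b) := by
  have hb : Continuous fun b : ↥(traceZeroAdele F E c) => (b : AdeleRing (𝓞 E) E) := continuous_subtype_val
  have hGL : Continuous fun b : ↥(traceZeroAdele F E c) =>
      (middleRootAdelicGLHom (N := 2) hij (Multiplicative.ofAdd b) : GL (Fin 2) (AdeleRing (𝓞 E) E)) := by
    refine Units.continuous_iff.2 ⟨?_, ?_⟩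
    · refine continuous_matrix fun p q => ?_
      change Continuous fun b : ↥(traceZeroAdele F E c) =>
        middleRootMatrix 2 0 1 ((b : ↥(traceZeroAdele F E c)) : AdeleRing (𝓞 E) E) p q
      simp only [middleRootMatrix_apply]
      exact continuous_const.add (by split_ifs <;> first | exact hb | exact continuous_const)
    · refine continuous_matrix fun p q => ?_
      change Continuous fun b : ↥(traceZeroAdele F E c) =>
        middleRootMatrix 2 0 1 (-((b : ↥(traceZeroAdele F E c)) : AdeleRing (𝓞 E) E)) p q
      simp only [middleRootMatrix_apply]
      exact continuous_const.add (by split_ifs <;> first | exact hb.neg | exact continuous_const)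
  exact (hGL.subtype_mk _).subtype_mk _

/-- The coordinate `u ↦ u₀₁` is continuous. [cite: Rogawski1990, §1.10] -/
theorem continuous_middleCoord_two : Continuous (middleCoord (F := F) (E := E) (c := c) hij hN) := by
  refine Continuous.subtype_mk ?_ _
  exact (Units.continuous_val.comp (continuous_subtype_val.comp continuous_subtype_val)).matrix_elem 0 1

/-- **The chart `𝔸_E⁻ → N(𝔸_F)`, `b ↦ n(b)`, is a homeomorphism.** [cite: Rogawski1990, §1.10] -/
theorem isHomeomorph_middleRootUnipotent_two :
    IsHomeomorph fun b : ↥(traceZeroAdele F E c) => middleRootUnipotent hij hN (Multiplicative.ofAdd b) := by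
  rw [isHomeomorph_iff_exists_inverse]
  refine ⟨continuous_middleRootUnipotent_two hij hN, middleCoord hij hN,
    middleCoord_middleRootUnipotent_two hij hN, fun u => (eq_middleRootUnipotent_two hij hN u).symm,
    continuous_middleCoord_two hij hN⟩

/-- `N(𝔸_F)` of `U(J₂)` is locally compact (homeomorphic to the closed subgroup `𝔸_E⁻` of `𝔸_E`).
[cite: Rogawski1990, §1.10] -/
theorem locallyCompactSpace_adelicUnipotent_two [LocallyCompactSpace (AdeleRing (𝓞 E) E)] :
    LocallyCompactSpace ↥(adelicUnipotent F E c 2) := by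
  have hij' : (((0 : Fin 2) : Fin 2) : ℕ) + 1 = (((1 : Fin 2) : Fin 2) : ℕ) := rfl
  have hN' : 2 = 2 * (((0 : Fin 2) : Fin 2) : ℕ) + 2 := rfl
  haveI := locallyCompactSpace_traceZeroAdele (F := F) (E := E) (c := c)
  exact ((isHomeomorph_middleRootUnipotent_two hij' hN').homeomorph _).symm.isClosedEmbedding.locallyCompactSpace

end Chart

/-! ## §2 Haar measure: transport of the additive Haar measure of `𝔸_E⁻` -/

section Haar

variable [MeasurableSpace (AdeleRing (𝓞 E) E)] [BorelSpace (AdeleRing (𝓞 E) E)]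
  [MeasurableSpace ↥(adelicUnipotent F E c 2)] [BorelSpace ↥(adelicUnipotent F E c 2)]

/-- The chart is a measurable embedding onto `N(𝔸_F)` (a homeomorphism). [cite: Rogawski1990, §1.10] -/
theorem measurableEmbedding_middleRootUnipotent_two :
    MeasurableEmbedding fun b : ↥(traceZeroAdele F E c) => middleRootUnipotent hij hN (Multiplicative.ofAdd b) :=
  ((isHomeomorph_middleRootUnipotent_two hij hN).homeomorph _).measurableEmbedding

/-- **Change of variables along the chart, `[0, ∞]`-valued**: `∫⁻ u, φ u ∂(n_* μ) = ∫⁻ b, φ (n b) ∂μ` for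
every measure `μ` on `𝔸_E⁻` and every `φ`. [cite: Rogawski1990, §1.10] -/
theorem lintegral_map_middleRootUnipotent_two (μY : Measure ↥(traceZeroAdele F E c))
    (φ : ↥(adelicUnipotent F E c 2) → ℝ≥0∞) :
    ∫⁻ u, φ u ∂(μY.map fun b => middleRootUnipotent hij hN (Multiplicative.ofAdd b)) =
      ∫⁻ b, φ (middleRootUnipotent hij hN (Multiplicative.ofAdd b)) ∂μY :=
  (measurableEmbedding_middleRootUnipotent_two hij hN).lintegral_map φ

/-- **Change of variables along the chart, Bochner**: `∫ u, φ u ∂(n_* μ) = ∫ b, φ (n b) ∂μ`.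
[cite: Rogawski1990, §1.10] -/
theorem integral_map_middleRootUnipotent_two (μY : Measure ↥(traceZeroAdele F E c))
    {V : Type*} [NormedAddCommGroup V] [NormedSpace ℝ V] (φ : ↥(adelicUnipotent F E c 2) → V) :
    ∫ u, φ u ∂(μY.map fun b => middleRootUnipotent hij hN (Multiplicative.ofAdd b)) =
      ∫ b, φ (middleRootUnipotent hij hN (Multiplicative.ofAdd b)) ∂μY :=
  (measurableEmbedding_middleRootUnipotent_two hij hN).integral_map φ

/-- Measure of a set under the transported measure: `(n_* μ)(A) = μ(n⁻¹ A)` for EVERY set `A`.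
[cite: Rogawski1990, §1.10] -/
theorem map_middleRootUnipotent_apply_two (μY : Measure ↥(traceZeroAdele F E c)) (A : Set ↥(adelicUnipotent F E c 2)) :
    (μY.map fun b => middleRootUnipotent hij hN (Multiplicative.ofAdd b)) A =
      μY ((fun b => middleRootUnipotent hij hN (Multiplicative.ofAdd b)) ⁻¹' A) :=
  (measurableEmbedding_middleRootUnipotent_two hij hN).map_apply μY A

omit [MeasurableSpace (AdeleRing (𝓞 E) E)] [BorelSpace (AdeleRing (𝓞 E) E)]
  [MeasurableSpace ↥(adelicUnipotent F E c 2)] [BorelSpace ↥(adelicUnipotent F E c 2)] in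
/-- Left translation by `n(b₀)` on `N(𝔸_F)` is, in the coordinate, translation by `b₀`.
[cite: Rogawski1990, §1.10] -/
theorem middleRootUnipotent_mul_comp_two (b₀ : ↥(traceZeroAdele F E c)) :
    ((fun u : ↥(adelicUnipotent F E c 2) => middleRootUnipotent hij hN (Multiplicative.ofAdd b₀) * u) ∘
        fun b : ↥(traceZeroAdele F E c) => middleRootUnipotent hij hN (Multiplicative.ofAdd b)) =
      (fun b : ↥(traceZeroAdele F E c) => middleRootUnipotent hij hN (Multiplicative.ofAdd b)) ∘ fun b => b₀ + b := by
  funext b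
  simp only [Function.comp_apply, middleRootUnipotent_add_two]

/-- **The transported measure is left invariant** (for a left invariant `μ` on `𝔸_E⁻`).
[cite: Rogawski1990, §1.10] -/
theorem isMulLeftInvariant_map_middleRootUnipotent_two (μY : Measure ↥(traceZeroAdele F E c))
    [μY.IsAddLeftInvariant] :
    (μY.map fun b => middleRootUnipotent hij hN (Multiplicative.ofAdd b)).IsMulLeftInvariant := by
  refine ⟨fun u₀ => ?_⟩
  have hm := (measurableEmbedding_middleRootUnipotent_two (F := F) (E := E) (c := c) hij hN).measurable
  obtain ⟨b₀, rfl⟩ := middleRootUnipotent_two_surjective hij hN u₀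
  change Measure.map (fun u => middleRootUnipotent hij hN (Multiplicative.ofAdd b₀) * u) _ = _
  rw [map_map (measurable_const_mul _) hm, middleRootUnipotent_mul_comp_two,
    ← map_map hm (measurable_const_add b₀), map_add_left_eq_self]

/-- **The transport of an additive Haar measure of `𝔸_E⁻` along `b ↦ n(b)` is a Haar measure on
`N(𝔸_F)`** (left invariant by the previous lemma; finite on compacts and positive on opens because
the chart is a homeomorphism). [cite: Rogawski1990, §1.10] -/
theorem isHaarMeasure_map_middleRootUnipotent_two (μY : Measure ↥(traceZeroAdele F E c)) [μY.IsAddHaarMeasure] :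
    (μY.map fun b => middleRootUnipotent hij hN (Multiplicative.ofAdd b)).IsHaarMeasure := by
  haveI := isMulLeftInvariant_map_middleRootUnipotent_two hij hN μY
  set e := (isHomeomorph_middleRootUnipotent_two (F := F) (E := E) (c := c) hij hN).homeomorph _ with he
  have hmap : (μY.map fun b => middleRootUnipotent hij hN (Multiplicative.ofAdd b)) = μY.map e.toMeasurableEquiv := rfl
  refine { lt_top_of_isCompact := fun C hC => ?_, open_pos := fun U hU hne => ?_ }
  · rw [hmap, MeasurableEquiv.map_apply]
    have : (e.toMeasurableEquiv : _ → ↥(adelicUnipotent F E c 2)) ⁻¹' C = e.symm '' C := by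
      rw [Homeomorph.image_symm]; rfl
    rw [this]
    exact (hC.image e.symm.continuous).measure_lt_top
  · rw [hmap, MeasurableEquiv.map_apply]
    refine (hU.preimage e.continuous).measure_ne_zero _ ?_
    obtain ⟨u, hu⟩ := hne
    exact ⟨e.symm u, show e (e.symm u) ∈ U by rwa [Homeomorph.apply_symm_apply]⟩

/-- **Every Haar measure of `N(𝔸_F)` is a constant multiple of the transported one** (uniqueness of
Haar measure on the second countable locally compact group `N(𝔸_F)`; the constant is Mathlib's
`haarScalarFactor`). [cite: Rogawski1990, §1.10] -/
theorem eq_haarScalarFactor_smul_map_middleRootUnipotent_two [LocallyCompactSpace (AdeleRing (𝓞 E) E)]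
    (ν : Measure ↥(adelicUnipotent F E c 2)) [ν.IsHaarMeasure]
    (μY : Measure ↥(traceZeroAdele F E c)) [μY.IsAddHaarMeasure] :
    haveI := isHaarMeasure_map_middleRootUnipotent_two hij hN μY
    ν = ν.haarScalarFactor (μY.map fun b => middleRootUnipotent hij hN (Multiplicative.ofAdd b)) •
      μY.map fun b => middleRootUnipotent hij hN (Multiplicative.ofAdd b) := by
  haveI := isHaarMeasure_map_middleRootUnipotent_two hij hN μY
  haveI := locallyCompactSpace_adelicUnipotent_two (F := F) (E := E) (c := c)
  haveI := secondCountableTopology_adeleRing E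
  haveI : SecondCountableTopology (quasiSplit F E c 2).Adelic :=
    inferInstanceAs (SecondCountableTopology (adelic F E c 2 ((StdForm.antidiagonal 2).over E)))
  haveI : SecondCountableTopology ↥(adelicUnipotent F E c 2) := TopologicalSpace.Subtype.secondCountableTopology _
  exact isMulLeftInvariant_eq_smul ν _

omit [MeasurableSpace (AdeleRing (𝓞 E) E)] [BorelSpace (AdeleRing (𝓞 E) E)] [BorelSpace ↥(adelicUnipotent F E c 2)] in
/-- `N(𝔸_F)` of `U(J₂)` is abelian, so every left invariant measure on it is right invariant.
[cite: Rogawski1990, §1.10] -/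
theorem isMulRightInvariant_of_isMulLeftInvariant_two (ν : Measure ↥(adelicUnipotent F E c 2))
    [ν.IsMulLeftInvariant] : ν.IsMulRightInvariant := by
  refine ⟨fun u₀ => ?_⟩
  have h : (fun u : ↥(adelicUnipotent F E c 2) => u * u₀) = fun u => u₀ * u :=
    funext fun u => mul_comm_adelicUnipotent_two u u₀
  rw [h]
  exact map_mul_left_eq_self ν u₀

end Haar

/-! ## §3 Rational points `N(F) = n(E⁻)` and the fundamental domain `n(𝓕⁻)` -/

section Lattice

/-- **`n(b) ∈ N(F)` iff `b ∈ E⁻`** (the trace-zero lattice `rationalTraceZero`): the rational points of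
the line are the principal trace-zero adeles. [cite: Rogawski1990, §1.10] -/
theorem middleRootUnipotent_mem_rationalUnipotent_iff_two (b : ↥(traceZeroAdele F E c)) :
    middleRootUnipotent hij hN (Multiplicative.ofAdd b) ∈ rationalUnipotent F E c 2 ↔
      b ∈ rationalTraceZero F E c := by
  constructor
  · intro h
    obtain ⟨g, hg⟩ := (mem_rationalUnipotent_iff _).1 h
    rw [mem_rationalTraceZero_iff]
    refine ⟨((g : GL (Fin 2) E) : Matrix (Fin 2) (Fin 2) E) 0 1, ?_⟩
    rw [← adelicVal_apply_eq_algebraMap hg 0 1]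
    exact unipotentEntry_middleRootUnipotent_self hij hN b
  · intro h
    obtain ⟨ξ, hξ⟩ := (mem_rationalTraceZero_iff _).1 h
    haveI : Nontrivial (AdeleRing (𝓞 E) E) := inferInstanceAs (Nontrivial (InfiniteAdeleRing E × FiniteAdeleRing (𝓞 E) E))
    have hξc : c ξ = -ξ := by
      have hb := (mem_traceZeroAdele_iff _).1 b.2
      rw [← hξ, ← algebraMap_conj, RingHom.coe_coe, ← map_neg] at hb
      exact (algebraMap E (AdeleRing (𝓞 E) E)).injective hb
    have hb' : b = ⟨algebraMap E (AdeleRing (𝓞 E) E) ξ, algebraMap_mem_traceZeroAdele hξc⟩ := Subtype.ext hξ.symm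
    rw [hb']
    exact middleRootUnipotent_algebraMap_mem hij hN hξc

/-- The coordinate of a rational element lies in `E⁻`. [cite: Rogawski1990, §1.10] -/
theorem middleCoord_mem_rationalTraceZero_two {γ : ↥(adelicUnipotent F E c 2)} (hγ : γ ∈ rationalUnipotent F E c 2) :
    middleCoord hij hN γ ∈ rationalTraceZero F E c := by
  rw [← middleRootUnipotent_mem_rationalUnipotent_iff_two hij hN, ← eq_middleRootUnipotent_two hij hN γ]
  exact hγ

/-- The left action of `γ ∈ N(F)` in the coordinate: `(γ • u)₀₁ = γ₀₁ + u₀₁`. [cite: Rogawski1990, §1.10] -/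
theorem middleCoord_smul_two (γ : ↥(rationalUnipotent F E c 2)) (u : ↥(adelicUnipotent F E c 2)) :
    middleCoord hij hN (γ • u) = middleCoord hij hN (γ : ↥(adelicUnipotent F E c 2)) + middleCoord hij hN u :=
  middleCoord_mul_two hij hN _ _

/-- Membership in the transported domain `n(𝓕⁻)` is membership of the coordinate in `𝓕⁻`.
[cite: CasselsFrohlichANT1967, Ch. XV Thm. 4.1.3 (1)] -/
theorem mem_image_traceZeroFundamentalDomain_iff_two (u : ↥(adelicUnipotent F E c 2)) :
    u ∈ (fun b : ↥(traceZeroAdele F E c) => middleRootUnipotent hij hN (Multiplicative.ofAdd b)) ''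
        traceZeroFundamentalDomain F E c ↔
      middleCoord hij hN u ∈ traceZeroFundamentalDomain F E c := by
  constructor
  · rintro ⟨b, hb, rfl⟩
    rwa [middleCoord_middleRootUnipotent_two]
  · intro h
    exact ⟨middleCoord hij hN u, h, (eq_middleRootUnipotent_two hij hN u).symm⟩

/-- **Unique representability**: every `u ∈ N(𝔸_F)` has exactly one left `N(F)`-translate in
`n(𝓕⁻)` (Tate's theorem for `E⁻ ⊂ 𝔸_E⁻`, ★ `existsUnique_vadd_mem_traceZeroFundamentalDomain`).
[cite: CasselsFrohlichANT1967, Ch. XV Thm. 4.1.3 (1)] -/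
theorem existsUnique_smul_mem_image_traceZeroFundamentalDomain_two (hc : c * c = 1) (u : ↥(adelicUnipotent F E c 2)) :
    ∃! γ : ↥(rationalUnipotent F E c 2),
      γ • u ∈ (fun b : ↥(traceZeroAdele F E c) => middleRootUnipotent hij hN (Multiplicative.ofAdd b)) ''
        traceZeroFundamentalDomain F E c := by
  obtain ⟨g, hg, hguniq⟩ := existsUnique_vadd_mem_traceZeroFundamentalDomain hc (middleCoord hij hN u)
  have hmemγ : ∀ g : ↥(rationalTraceZero F E c),
      middleRootUnipotent hij hN (Multiplicative.ofAdd (g : ↥(traceZeroAdele F E c))) ∈ rationalUnipotent F E c 2 :=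
    fun g => (middleRootUnipotent_mem_rationalUnipotent_iff_two hij hN _).2 g.2
  refine ⟨⟨_, hmemγ g⟩, ?_, ?_⟩
  · show (⟨_, hmemγ g⟩ : ↥(rationalUnipotent F E c 2)) • u ∈ _
    rw [mem_image_traceZeroFundamentalDomain_iff_two, middleCoord_smul_two]
    change middleCoord hij hN (middleRootUnipotent hij hN (Multiplicative.ofAdd (g : ↥(traceZeroAdele F E c)))) +
      middleCoord hij hN u ∈ _
    rw [middleCoord_middleRootUnipotent_two]
    exact hg
  · intro γ hγ
    change γ • u ∈ _ at hγ
    rw [mem_image_traceZeroFundamentalDomain_iff_two, middleCoord_smul_two] at hγ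
    have hγ' := hguniq ⟨middleCoord hij hN (γ : ↥(adelicUnipotent F E c 2)),
      middleCoord_mem_rationalTraceZero_two hij hN γ.2⟩ hγ
    apply Subtype.ext
    rw [eq_middleRootUnipotent_two hij hN (γ : ↥(adelicUnipotent F E c 2))]
    change middleRootUnipotent hij hN (Multiplicative.ofAdd (middleCoord hij hN (γ : ↥(adelicUnipotent F E c 2)))) =
      middleRootUnipotent hij hN (Multiplicative.ofAdd (g : ↥(traceZeroAdele F E c)))
    rw [← hγ']

/-- `n(𝓕⁻)` lies in a compact set. [cite: CasselsFrohlichANT1967, Ch. XV Thm. 4.1.3 (2)] -/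
theorem exists_isCompact_image_traceZeroFundamentalDomain_subset_two (hc : c * c = 1) :
    ∃ C : Set ↥(adelicUnipotent F E c 2), IsCompact C ∧
      (fun b : ↥(traceZeroAdele F E c) => middleRootUnipotent hij hN (Multiplicative.ofAdd b)) ''
        traceZeroFundamentalDomain F E c ⊆ C := by
  obtain ⟨K, hK, hsub⟩ := exists_isCompact_traceZeroFundamentalDomain_subset (F := F) (E := E) (c := c) hc
  exact ⟨_, hK.image (continuous_middleRootUnipotent_two hij hN), Set.image_mono hsub⟩

variable [MeasurableSpace (AdeleRing (𝓞 E) E)] [BorelSpace (AdeleRing (𝓞 E) E)]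
  [MeasurableSpace ↥(adelicUnipotent F E c 2)] [BorelSpace ↥(adelicUnipotent F E c 2)]

/-- `n(𝓕⁻)` is a Borel set. [cite: CasselsFrohlichANT1967, Ch. XV Thm. 4.1.3 (1)] -/
theorem measurableSet_image_traceZeroFundamentalDomain_two :
    MeasurableSet ((fun b : ↥(traceZeroAdele F E c) => middleRootUnipotent hij hN (Multiplicative.ofAdd b)) ''
      traceZeroFundamentalDomain F E c) :=
  (measurableEmbedding_middleRootUnipotent_two hij hN).measurableSet_image.2 measurableSet_traceZeroFundamentalDomain

/-- **`n(𝓕⁻)` is a measurable fundamental domain for the left translation action of `N(F)` on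
`N(𝔸_F)`**, for every measure (Mathlib `IsFundamentalDomain.mk'` from unique representability) — the
`N = 2` replacement of ★ `isFundamentalDomain_heisFundamentalDomain`.
[cite: CasselsFrohlichANT1967, Ch. XV Thm. 4.1.3 (1)] -/
theorem isFundamentalDomain_image_traceZeroFundamentalDomain_two (hc : c * c = 1)
    (μ : Measure ↥(adelicUnipotent F E c 2)) :
    IsFundamentalDomain ↥(rationalUnipotent F E c 2)
      ((fun b : ↥(traceZeroAdele F E c) => middleRootUnipotent hij hN (Multiplicative.ofAdd b)) ''
        traceZeroFundamentalDomain F E c) μ :=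
  IsFundamentalDomain.mk' (measurableSet_image_traceZeroFundamentalDomain_two hij hN).nullMeasurableSet
    (existsUnique_smul_mem_image_traceZeroFundamentalDomain_two hij hN hc)

omit [MeasurableSpace (AdeleRing (𝓞 E) E)] [BorelSpace (AdeleRing (𝓞 E) E)] [BorelSpace ↥(adelicUnipotent F E c 2)] in
/-- `n(𝓕⁻)` has finite measure for every measure finite on compact sets.
[cite: CasselsFrohlichANT1967, Ch. XV Thm. 4.1.3 (2)] -/
theorem measure_image_traceZeroFundamentalDomain_lt_top_two (hc : c * c = 1)
    (μ : Measure ↥(adelicUnipotent F E c 2)) [IsFiniteMeasureOnCompacts μ] :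
    μ ((fun b : ↥(traceZeroAdele F E c) => middleRootUnipotent hij hN (Multiplicative.ofAdd b)) ''
      traceZeroFundamentalDomain F E c) < ⊤ := by
  obtain ⟨C, hC, hsub⟩ := exists_isCompact_image_traceZeroFundamentalDomain_subset_two (F := F) (E := E) (c := c) hij hN hc
  exact (measure_mono hsub).trans_lt hC.measure_lt_top

end Lattice

end UnitaryGroup

end Literature.NumberTheory.Automorphic
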